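import Summits.BirchSwinnertonDyer.BirchSwinnertonDyer.Theorems.ErratumRoadFiveEulerHalfNotRamTateComponentLocal
import Summits.BirchSwinnertonDyer.Rank1Residual.X11b.KolyvaginPointInertia
import HarnessLib

/-!
# ErratumRoadFive, crux `EulerHalfNotRamNoInertSetAtFive` (stmt-BirchSwinnertonDyer-19715), ideator line
# `aux_norm_receptacle`, stub S1 — step F2 (global → local, part 1): points of `E(K[n])` pushed to `E(K̄_v)`
# are INERTIA-FIXED for `v ∤ n`, and their receptacle membership is nonsingular reduction at the place cut out

Cell `bsd-stepL`, width seat `bsd-line-er5-p1-w3` g6. THEOREMS ONLY (no definition, no named fact, no `sorry`);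
`--supports stmt-BirchSwinnertonDyer-19715`. HONEST FRAMING: kernel plumbing for the ideator's stub S1
(`TateComponentFamily[Linear]`); nothing closes 19715; item 27982 untouched; no summit statement is proved; BSD is
proved for no curve.

## What

For `W/ℚ`, `K` imaginary quadratic with the ring class tower `K[n] = ringClassField K ι n ⊂ ℂ`, a `K`-embedding
`e : K[n] → K̄`, a finite place `v` of `K`, and the push-forward
`E_e := pointsMap (W ⊗ K) K_v ∘ Point.map e : E(K[n]) → E(K̄) → E(K̄_v) = localPoints (W ⊗ K) K_v`:

* `smul_pointsMap_map_eq_self_of_mem_inertia` — **`E_e(P)` is fixed by the local inertia group at `v ∤ n`**: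
  `τ • E_e P = E_e P` for every prime `𝔐` of `\bar 𝓞_v` above `𝓂_v` and every `τ ∈ I_𝔐 ≤ Γ_{K_v}` — the
  ring class field `K[n]/K` is unramified at `v ∤ n` (Cox §9.A; tree
  `KolyvaginH44.resGal_smul_algHom_ringClassField_eq_self`) and `pointsMap` is `Γ_{K_v}`-equivariant along
  `res : Γ_{K_v} → Γ_K` (`pointsMap_smul`). Hence `E_e(E(K[n]))` lies in the domain `Dom` of the local Tate
  component character (`TateComponent.exists_componentHom_localPoints`, (1)).
* `pointsMap_map_mem_E0Receptacle_iff` — **`E_e(P) ∈ E⁰(K̄_v) ↔ P ∈ E₀(K[n])_w`** for the place `w` of `K[n]`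
  cut out by `K[n] → K̄ → K̄_v` (JET's G-rec `mem_E0Receptacle_some_iff_hasNonsingularReduction_placeIntModel`,
  extended from affine points to all points), `W/ℚ` with integer coefficients and `(W ⊗ K) ⊗ K_v` minimal.
  This is clause (K1) of S1 read through (3) of the local character.

References (locators only): [cite: Cox2013, §9.A (p. 181)] [cite: NeukirchANT1999, Ch. II §9 (9.6)]
[cite: SilvermanAEC2009, VII.§2, VII.1 Prop. 1.3 (b)] [cite: GrossLMS1991, §6 p. 245].
-/

set_option linter.dupNamespace false

noncomputable section

open scoped Classical NNReal
open NumberField IsDedekindDomain Field WeierstrassCurve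

universe u

namespace Summit.BirchSwinnertonDyer.BirchSwinnertonDyer.Theorems.TateComponent

open Literature.NumberTheory.EllipticCurves Literature.NumberTheory.GaloisRepresentations
  IsDedekindDomain.HeightOneSpectrum Summit.BirchSwinnertonDyer.Rank1Residual.X11b
  Summit.BirchSwinnertonDyer.Rank1Residual.X11b.KolyvaginH44

variable {K : Type} [Field K] [NumberField K]

/-! ## Inertia-fixedness of the pushed-forward points of `E(K[n])` -/

/-- **`E_e(P)` is fixed by the local inertia group at `v ∤ n`.** For `K` imaginary quadratic, `n ≥ 1`, a finite
place `v` of `K` with `n ∉ v`, a prime `𝔐` of `\bar 𝓞_v` above `𝓂_v`, `τ` in its inertia group `I_𝔐 ≤ Γ_{K_v}`,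
a `K`-embedding `e : K[n] → K̄`, `W/ℚ`, and `P ∈ E(K[n])`: the image of `P` in `E(K̄_v)` (along `e` and the
chosen `K̄ → K̄_v`) satisfies `τ • E_e P = E_e P`. (`res τ ∈ Γ_K` fixes `e(K[n])` pointwise —
`KolyvaginH44.resGal_smul_algHom_ringClassField_eq_self`, Cox §9.A: `K[n]/K` is unramified outside `n` — so it
fixes the coordinates of `Point.map e P`; and `pointsMap (res τ • Q) = τ • pointsMap Q`.)
[cite: Cox2013, §9.A (p. 181)] [cite: NeukirchANT1999, Ch. II §9 (9.6)] -/
theorem smul_pointsMap_map_eq_self_of_mem_inertia (hK : IsImaginaryQuadratic K) (ι : K →+* ℂ)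
    {n : ℕ} (hn : n ≠ 0) (e : ringClassField K ι n →ₐ[K] AlgebraicClosure K)
    {v : HeightOneSpectrum (𝓞 K)} (hv : ((n : ℕ) : 𝓞 K) ∉ v.asIdeal)
    {𝔐 : Ideal v.localAbsIntegers} (h𝔐 : 𝔐 ∈ v.localPrimesAbove)
    {τ : absoluteGaloisGroup (v.adicCompletion K)}
    (hτ : τ ∈ 𝔐.inertia (absoluteGaloisGroup (v.adicCompletion K)))
    (W : WeierstrassCurve ℚ) (P : (W.baseChange (ringClassField K ι n)).toAffine.Point) :
    τ • pointsMap (W.baseChange K) (v.adicCompletion K)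
        (Affine.Point.map (W' := W) (e.restrictScalars ℚ) P) =
      pointsMap (W.baseChange K) (v.adicCompletion K) (Affine.Point.map (W' := W) (e.restrictScalars ℚ) P) := by
  have hfix : ∀ x : ringClassField K ι n, resGal (K := K) (v.adicCompletion K) τ • e x = e x :=
    fun x ↦ resGal_smul_algHom_ringClassField_eq_self hK ι hn e hv h𝔐 hτ x
  set Q : geomPoints (W.baseChange K) := Affine.Point.map (W' := W) (e.restrictScalars ℚ) P with hQdef
  -- `res τ` fixes `Q = Point.map e P`
  have key : resGal (K := K) (v.adicCompletion K) τ • Q = Q := by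
    rcases P with _ | ⟨x, y, h⟩
    · have hQ0 : Q = 0 := rfl
      rw [hQ0, smul_zero]
    · have hxy' : ((W.baseChange K).baseChange (AlgebraicClosure K)).toAffine.Nonsingular (e x) (e y) :=
        (Affine.baseChange_nonsingular W (e.restrictScalars ℚ).injective x y).mpr h
      have hQ : Q = (.some (e x) (e y) hxy' : geomPoints (W.baseChange K)) := by
        rw [hQdef, Affine.Point.map_some]
        rfl
      rw [hQ]
      change Affine.Point.map (W' := W.baseChange K)
        ((show AlgebraicClosure K ≃ₐ[K] AlgebraicClosure K from resGal (K := K) (v.adicCompletion K) τ) :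
          AlgebraicClosure K →ₐ[K] AlgebraicClosure K) (.some (e x) (e y) hxy') = _
      rw [Affine.Point.map_some]
      exact Affine.Point.some_eq_some_of_eq (hfix x) (hfix y)
  rw [← pointsMap_smul, key]

/-! ## Receptacle membership of the pushed-forward points -/

/-- **`E_e(P) ∈ E⁰(K̄_v) ↔ P ∈ E₀(L)_w`** at the place `w` of the number field `L` cut out by
`L → K̄ → K̄_v`: for `W/ℚ` with integer coefficients, `(W ⊗ K) ⊗ K_v` minimal, `e : L → K̄` a `K`-embedding and
`w` a place of `L` equivalent to `|ι_v (e ·)|_v` (`ι_v : K̄ → K̄_v` the chosen embedding), every `P ∈ E(L)`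
satisfies: `pointsMap (W ⊗ K) K_v (Point.map e P) ∈ E0Receptacle (W ⊗ K) v` iff `P` has nonsingular reduction on
`placeIntModel W L w` (JET's G-rec, at `O` trivially). [cite: SilvermanAEC2009, VII.§2 (E₀), VII.1 Prop. 1.3 (b)]
[cite: GrossLMS1991, §6, proof of Prop. 6.2 (1), p. 245] -/
theorem pointsMap_map_mem_E0Receptacle_iff (W : WeierstrassCurve ℚ) [W.IsIntegral ℤ] [W.IsElliptic]
    (v : HeightOneSpectrum (𝓞 K)) {w₀ : Valuation (AlgebraicClosure (v.adicCompletion K)) ℝ≥0}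
    (hw₀ : ∀ z, (w₀ z : ℝ) = spectralNorm (v.adicCompletion K) (AlgebraicClosure (v.adicCompletion K)) z)
    (hmin : ((W.baseChange K).baseChange (v.adicCompletion K)).IsMinimal (v.adicCompletionIntegers K))
    {L : Type} [Field L] [NumberField L] [Algebra K L] (e : L →ₐ[K] AlgebraicClosure K)
    {w : HeightOneSpectrum (𝓞 L)}
    (hwe : (w.valuation L).IsEquiv (w₀.comap
      (((closureEmb (K := K) (v.adicCompletion K)).restrictScalars ℚ).comp (e.restrictScalars ℚ) :
        L →+* AlgebraicClosure (v.adicCompletion K))))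
    (P : (W.baseChange L).toAffine.Point) :
    pointsMap (W.baseChange K) (v.adicCompletion K) (Affine.Point.map (W' := W) (e.restrictScalars ℚ) P) ∈
        E0Receptacle (W.baseChange K) v ↔
      (placeIntModel W L w).HasNonsingularReduction (K := L) P := by
  set f' : L →ₐ[ℚ] AlgebraicClosure (v.adicCompletion K) :=
    ((closureEmb (K := K) (v.adicCompletion K)).restrictScalars ℚ).comp (e.restrictScalars ℚ) with hf'
  rcases P with _ | ⟨x, y, hxy⟩
  · have h0 : pointsMap (W.baseChange K) (v.adicCompletion K)
        (Affine.Point.map (W' := W) (e.restrictScalars ℚ) .zero) = 0 := rfl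
    rw [h0]
    exact ⟨fun _ ↦ WeierstrassCurve.hasNonsingularReduction_zero (K := L) (W := placeIntModel W L w),
      fun _ ↦ zero_mem _⟩
  · have hxy' : ((W.baseChange K).baseChange (AlgebraicClosure K)).toAffine.Nonsingular (e x) (e y) :=
      (Affine.baseChange_nonsingular W (e.restrictScalars ℚ).injective x y).mpr hxy
    have h' : ((W.baseChange K).baseChange (AlgebraicClosure (v.adicCompletion K))).toAffine.Nonsingular
        ((f' : L →+* AlgebraicClosure (v.adicCompletion K)) x)
        ((f' : L →+* AlgebraicClosure (v.adicCompletion K)) y) :=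
      (Affine.baseChange_nonsingular W f'.injective x y).mpr hxy
    have hQ : pointsMap (W.baseChange K) (v.adicCompletion K)
        (Affine.Point.map (W' := W) (e.restrictScalars ℚ) (.some x y hxy)) = .some _ _ h' := by
      rw [Affine.Point.map_some]
      change Affine.Point.map (W' := W.baseChange K) (closureEmb (K := K) (v.adicCompletion K))
        (.some (e x) (e y) hxy') = _
      rw [Affine.Point.map_some]
      rfl
    exact Summit.BirchSwinnertonDyer.Rank1Residual.JET.mem_E0Receptacle_some_iff_hasNonsingularReduction_placeIntModel
      W v hw₀ hmin (f' : L →+* AlgebraicClosure (v.adicCompletion K)) hwe hxy h' hQ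

end Summit.BirchSwinnertonDyer.BirchSwinnertonDyer.Theorems.TateComponent

end
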